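import Summits.CriticalPhenomena.SAWScalingLimit.Theses.SAWLeftRightFKG
import Summits.CriticalPhenomena.SAWScalingLimit.Theorems.FKGToTraversalBound.Negative.DeepEndpointGap
import Summits.CriticalPhenomena.SAWScalingLimit.Theorems.LeftRightFKG.Negative.BoxMesh
import Summits.CriticalPhenomena.SAWScalingLimit.Theorems.LeftRightFKG.Negative.OrderCharacterisation
import Summits.CriticalPhenomena.SAWScalingLimit.Theorems.BoundaryTP2Negative_Box3
import Summits.CriticalPhenomena.SAWScalingLimit.Theorems.SAWLeftRightFKGNotFKGAtOneWindBox
import Summits.CriticalPhenomena.SAWScalingLimit.Theorems.SAWLeftRightFKGNotFKGAtOneBoxCensus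
import Summits.CriticalPhenomena.SAWScalingLimit.Theorems.SAWLeftRightFKGNotFKGAtOneMeshBox

/-!
# Line `three-by-three-corner-witness` — LEAD skeleton for crux `NotFKGAtOne` (stmt-CriticalPhenomena-11233)

Lead prover's working copy of `Cruxes/NotFKGAtOne/Lines/three-by-three-corner-witness.lean` (planner
planner-cruxplan-stmt-CriticalPhenomena-11233-three-by-three-corne-0), re-keyed to the LANDED vocabulary:
the crux's `let Ω` / `let le` are `FKGToTraversalBound.Negative.dom C δ` / `lrLE` (DeepEndpointGap.lean),
sites are `LeftRightFKG.Negative.bx i j` with corner `c₀ = (-1,-1)`, and the new objects `sq3`, `Rint₃`,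
`cornerA`, `cornerB`, `sq3` are line-local (workfile) names only: the registered stub signatures are
spelled out over LANDED vocabulary (stub 1 is stated for ANY closed walk `C` based at `c₀` whose support is
the boundary cycle of `[-1,3]²`, pinned as an explicit vertex list), so neither the stub files nor the final
assembly need a single new definition in the tree (`exists_sq3` packages the witness walk as an `∃`).

Composition: `NotFKGAtOne_of : Registered.stub_windBox → Registered.stub_meshBox →
Registered.stub_boxCensus → NotFKGAtOne` (sorry-free).  STATUS: ALL THREE STUBS LANDED (p83727 WindBox, p84036
MeshBox, p83729 BoxCensus) — this file is now sorry-free; the def-free tree version of the assembly is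
`Theorems/SAWLeftRightFKGNotFKGAtOne.lean` (`Theorems.NotFKGAtOne.notFKGAtOne : NotFKGAtOne`).  See the tree skeleton's docstring for the line in one paragraph and the Disproof used.
-/

noncomputable section

open scoped ENNReal
open MeasureTheory Set Literature.Probability.LatticeModels Literature.Probability.RandomPlanarGeometry
  Literature.Topology.PlaneTopology Summit.CriticalPhenomena.SAWScalingLimit.Theses.SAWLeftRightFKG
open Summit.CriticalPhenomena.SAWScalingLimit.Theorems.LeftRightFKG.Negative
open Summit.CriticalPhenomena.SAWScalingLimit.Theorems.FKGToTraversalBound.Negative (dom lrLE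
  notMem_dom_of_mem_support)
open Summit.CriticalPhenomena.SAWScalingLimit.Theorems.BoundaryTP2.Negative
  (pathsFrom endsAt eqSite eqSite_iff nb₃ inBox₃ inBox₃_iff Ω₃ adj₃_iff mem_nb₃ nb₃_adj T₃ mem_T₃_iff
   card_T₃ length_lt_card_of_adj_mem zdGraph_adj_cases zdGraph_adj_of_cases support_mem_pathsFrom
   exists_walk_of_mem_pathsFrom walk_eq_of_support_eq endsAt_support)

namespace Summit.CriticalPhenomena.SAWScalingLimit.Cruxes.NotFKGAtOne.ThreeByThreeCornerWitness

/-! ## §D The witness walk (workfile name `sq3`; the tree sees it only through `exists_sq3`) -/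

/-- **The boundary walk `C₃ = ∂[-1,3]²`**: a closed walk of `ℤ²` of length 16 based at `c₀ = (-1,-1)`,
counter-clockwise. [folklore] -/
def sq3 : (zdGraph 2).Walk c₀ c₀ :=
  .cons (adj_bx (-1) (-1) 0 (-1) (by decide)) <| .cons (adj_bx 0 (-1) 1 (-1) (by decide)) <|
  .cons (adj_bx 1 (-1) 2 (-1) (by decide)) <| .cons (adj_bx 2 (-1) 3 (-1) (by decide)) <|
  .cons (adj_bx 3 (-1) 3 0 (by decide)) <| .cons (adj_bx 3 0 3 1 (by decide)) <|
  .cons (adj_bx 3 1 3 2 (by decide)) <| .cons (adj_bx 3 2 3 3 (by decide)) <|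
  .cons (adj_bx 3 3 2 3 (by decide)) <| .cons (adj_bx 2 3 1 3 (by decide)) <|
  .cons (adj_bx 1 3 0 3 (by decide)) <| .cons (adj_bx 0 3 (-1) 3 (by decide)) <|
  .cons (adj_bx (-1) 3 (-1) 2 (by decide)) <| .cons (adj_bx (-1) 2 (-1) 1 (by decide)) <|
  .cons (adj_bx (-1) 1 (-1) 0 (by decide)) <| .cons (adj_bx (-1) 0 (-1) (-1) (by decide)) <| .nil

/-- The boundary cycle of `[-1,3]²` as an explicit vertex list (counter-clockwise from `(0,-1)` back to
`c₀ = (-1,-1)`): the support of `sq3` without its head. [folklore] -/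
def bdry₃ : List (Site 2) :=
  [bx 0 (-1), bx 1 (-1), bx 2 (-1), bx 3 (-1), bx 3 0, bx 3 1, bx 3 2, bx 3 3,
        bx 2 3, bx 1 3, bx 0 3, bx (-1) 3, bx (-1) 2, bx (-1) 1, bx (-1) 0, c₀]

/-- `sq3` traces exactly the boundary cycle. [folklore] -/
theorem sq3_support_tail : sq3.support.tail = bdry₃ := rfl

/-- **The witness walk, existentially** (the only form in which the tree-side files see it: no definition
is landed): a closed lattice walk based at `c₀` whose support is the boundary cycle of `[-1,3]²`. [folklore] -/
theorem exists_sq3 : ∃ C : (zdGraph 2).Walk c₀ c₀, C.support.tail =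
      [bx 0 (-1), bx 1 (-1), bx 2 (-1), bx 3 (-1), bx 3 0, bx 3 1, bx 3 2, bx 3 3,
        bx 2 3, bx 1 3, bx 0 3, bx (-1) 3, bx (-1) 2, bx (-1) 1, bx (-1) 0, c₀] :=
  ⟨sq3, rfl⟩

/-! ## §0 Statements (spelled-out predicates of the line) -/

/-- The open square `(-1, 3)²` — the interior of the trace of `sq3` (spelled out in the stub signatures). [folklore] -/
def Rint₃ : Set ℂ := {z : ℂ | (-1 < z.re ∧ z.re < 3) ∧ (-1 < z.im ∧ z.im < 3)}

/-- The corner event at `a = (0,0)`: `{1 ≤ wcross 0 0 γ}` (first step North). [folklore] -/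
def cornerA (Ω : Set ℂ) : Set (SAW.DomainSAW Ω 1 (bx 0 0) (bx 2 2)) :=
  {γ | 1 ≤ wcross 0 0 γ.walk}

/-- The corner event at `b = (2,2)`: `{1 ≤ wcross 1 1 γ}` (last step East). [folklore] -/
def cornerB (Ω : Set ℂ) : Set (SAW.DomainSAW Ω 1 (bx 0 0) (bx 2 2)) :=
  {γ | 1 ≤ wcross 1 1 γ.walk}

/-- "The discrete domain graph of `Ω` (mesh `1`) is `ℤ²` induced on the 3 × 3 box" — the exact shape of
the tree's `BoundaryTP2.Negative.adj₃_iff`. [folklore] -/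
def BoxAdj (Ω : Set ℂ) : Prop :=
  ∀ x y : Site 2, (discreteDomainGraph Ω 1).Adj x y ↔
    (zdGraph 2).Adj x y ∧ x ∈ boxSites ![0, 0] ![2, 2] ∧ y ∈ boxSites ![0, 0] ![2, 2]

/-- The four counts of the certificate over the chords `(0,0) → (2,2)` of `Ω_1`. [folklore] -/
def Counts (Ω : Set ℂ) : Prop :=
  Measure.count (cornerA Ω) = 6 ∧ Measure.count (cornerB Ω) = 6 ∧
    Measure.count (univ : Set (SAW.DomainSAW Ω 1 (bx 0 0) (bx 2 2))) = 12 ∧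
    Measure.count (cornerA Ω ∩ cornerB Ω) = 2

/-- STATEMENT OF STUB 1 (winding numbers of the boundary walk), for ANY closed walk `C` based at `c₀`
tracing the boundary cycle of `[-1,3]²`: the open square lies in `Ω(C) = {wind(C,·) ≠ 0}` and the mesh-`1`
vertices of `Ω(C)` are exactly the box `{0,1,2}²`. [folklore] -/
def WindBox : Prop :=
  ∀ C : (zdGraph 2).Walk c₀ c₀, C.support.tail =
      [bx 0 (-1), bx 1 (-1), bx 2 (-1), bx 3 (-1), bx 3 0, bx 3 1, bx 3 2, bx 3 3,
        bx 2 3, bx 1 3, bx 0 3, bx (-1) 3, bx (-1) 2, bx (-1) 1, bx (-1) 0, c₀] →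
    Rint₃ ⊆ dom C 1 ∧ meshVertices (dom C 1) 1 = boxSites ![0, 0] ![2, 2]

/-- STATEMENT OF STUB 2 (the discrete domain of such an `Ω` is the induced box graph). [folklore] -/
def MeshBox : Prop :=
  ∀ Ω : Set ℂ, Rint₃ ⊆ Ω → meshVertices Ω 1 = boxSites ![0, 0] ![2, 2] → BoxAdj Ω

/-- STATEMENT OF STUB 3 (certified census). [folklore] -/
def BoxCensus : Prop :=
  ∀ Ω : Set ℂ, BoxAdj Ω → Counts Ω

/-! ## §1 Sanity (kernel): boundary data of the witness and the list-side census -/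

/-- `(0,-1)` is a boundary vertex (below `a = (0,0)`). [folklore] -/
theorem mem_sq3_support_a' : bx 0 (-1) ∈ sq3.support := by decide

/-- `(2,3)` is a boundary vertex (above `b = (2,2)`). [folklore] -/
theorem mem_sq3_support_b' : bx 2 3 ∈ sq3.support := by decide

/-- `a ∼ a'`. [folklore] -/
theorem adj_a_a' : (zdGraph 2).Adj (bx 0 0) (bx 0 (-1)) := adj_bx 0 0 0 (-1) (by decide)

/-- `b ∼ b'`. [folklore] -/
theorem adj_b_b' : (zdGraph 2).Adj (bx 2 2) (bx 2 3) := adj_bx 2 2 2 3 (by decide)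

/-- The crossing count of `sq3` over the probe of the face `(0,0)` (the top side is traversed westward). [folklore] -/
theorem pathCross_sq3 : pathCross 0 0 c₀ sq3.support.tail = -1 := by decide

/-- The enumerated corner-to-corner supports of the 3 × 3 box. [folklore] -/
def chords₃ : List (List (Site 2)) :=
  (pathsFrom eqSite nb₃ 8 (bx 0 0) []).filter (endsAt eqSite (bx 2 2))

/-- **Census (kernel `decide`)**: 12 chords; 6 with `1 ≤ pathCross 0 0`; 6 with `1 ≤ pathCross 1 1`;
2 with both; duplicate-free. [folklore] -/
theorem census_decide :
    chords₃.length = 12 ∧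
    (chords₃.filter fun s => decide (1 ≤ pathCross 0 0 (bx 0 0) s.tail)).length = 6 ∧
    (chords₃.filter fun s => decide (1 ≤ pathCross 1 1 (bx 0 0) s.tail)).length = 6 ∧
    (chords₃.filter fun s =>
      decide (1 ≤ pathCross 0 0 (bx 0 0) s.tail) && decide (1 ≤ pathCross 1 1 (bx 0 0) s.tail)).length = 2 ∧
    chords₃.Nodup := by
  decide

/-! ## §2 The ORDER side — proved -/

/-- Crossing-count superlevel events are `≼`-up-closed in EVERY domain (`δ = 1`). [folklore] -/
theorem le_wcross_of_lr {Ω : Set ℂ} {a b : Site 2} (m k c : ℤ) (γ₁ γ₂ : SAW.DomainSAW Ω 1 a b)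
    (h : lrLE γ₁ γ₂) (h₁ : c ≤ wcross m k γ₁.walk) : c ≤ wcross m k γ₂.walk := by
  have hG : ∀ x y, (discreteDomainGraph Ω 1).Adj x y → (zdGraph 2).Adj x y := fun x y hxy =>
    meshGraph_le_zdGraph Ω 1 (discreteDomainGraph_le_meshGraph Ω 1 hxy)
  classical
  obtain ⟨Y, hY⟩ := Finset.exists_le
    (insert k (((γ₁.walk.support ++ γ₂.walk.support).map fun x : Site 2 => x 1).toFinset))
  have hkY : k ≤ Y := hY k (Finset.mem_insert_self _ _)
  have hs : ∀ x ∈ γ₁.walk.support ++ γ₂.walk.support, x 1 ≤ Y := fun x hx =>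
    hY (x 1) (Finset.mem_insert_of_mem (List.mem_toFinset.2 (List.mem_map.2 ⟨x, hx, rfl⟩)))
  have key := wcross_le_of_wind_nonneg hG γ₁.walk γ₂.walk hkY
    (fun x hx => hs x (List.mem_append_left _ hx)) (fun x hx => hs x (List.mem_append_right _ hx))
    (h (probeL m k))
  omega

/-- `cornerA Ω` is `≼`-up-closed. [folklore] -/
theorem isUp_cornerA (Ω : Set ℂ) :
    ∀ γ₁ γ₂, lrLE γ₁ γ₂ → γ₁ ∈ cornerA Ω → γ₂ ∈ cornerA Ω :=
  fun γ₁ γ₂ h h₁ => le_wcross_of_lr 0 0 1 γ₁ γ₂ h h₁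

/-- `cornerB Ω` is `≼`-up-closed. [folklore] -/
theorem isUp_cornerB (Ω : Set ℂ) :
    ∀ γ₁ γ₂, lrLE γ₁ γ₂ → γ₁ ∈ cornerB Ω → γ₂ ∈ cornerB Ω :=
  fun γ₁ γ₂ h h₁ => le_wcross_of_lr 1 1 1 γ₁ γ₂ h h₁

/-! ## §3 Registered stubs (signatures spelled out over LANDED vocabulary + `sq3`) -/

/-- STUB 1 (M) — `WindBox` — LANDED (p83727, `Theorems/SAWLeftRightFKGNotFKGAtOneWindBox.lean`): for any closed walk `C` at `c₀` tracing the boundary cycle of `[-1,3]²`, the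
open square `(-1,3)²` lies in `Ω(C) = {wind(C, ·) ≠ 0}` and the mesh-`1` vertices of `Ω(C)` are exactly the
box `{0,1,2}²`.  Replay of the landed `LeftRightFKG/Negative/BoxDomain.lean` (`Rint_subset_Ωb`,
`meshVertices_Ωb`) at `3 × 3`, with the concrete polyline supplied by the support hypothesis
(`iccExtend_toCurve_apply`, `wind_poly_probeL`, `notMem_dom_of_mem_support`, `wind_poly_eq_zero_far`). [folklore] -/
theorem stub_windBox :
    ∀ C : (zdGraph 2).Walk c₀ c₀, C.support.tail =
        [bx 0 (-1), bx 1 (-1), bx 2 (-1), bx 3 (-1), bx 3 0, bx 3 1, bx 3 2, bx 3 3,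
        bx 2 3, bx 1 3, bx 0 3, bx (-1) 3, bx (-1) 2, bx (-1) 1, bx (-1) 0, c₀] →
      {z : ℂ | (-1 < z.re ∧ z.re < 3) ∧ (-1 < z.im ∧ z.im < 3)} ⊆ dom C 1 ∧
        meshVertices (dom C 1) 1 = boxSites ![0, 0] ![2, 2] := by
  exact Summit.CriticalPhenomena.SAWScalingLimit.Theorems.NotFKGAtOne.stub_windBox

/-- STUB 2 (S/M) — `MeshBox` — LANDED (p84036, `Theorems/SAWLeftRightFKGNotFKGAtOneMeshBox.lean`): for ANY `Ω` containing the open square whose mesh-`1` vertices are the box,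
adjacency in `discreteDomainGraph Ω 1` is lattice adjacency inside the box.  Replay of the landed
`LeftRightFKG/Negative/BoxMesh.lean` (`meshDomain_Ωb`, `dAdj_iff`). [folklore] -/
theorem stub_meshBox :
    ∀ Ω : Set ℂ, {z : ℂ | (-1 < z.re ∧ z.re < 3) ∧ (-1 < z.im ∧ z.im < 3)} ⊆ Ω →
      meshVertices Ω 1 = boxSites ![0, 0] ![2, 2] →
      ∀ x y : Site 2, (discreteDomainGraph Ω 1).Adj x y ↔
        (zdGraph 2).Adj x y ∧ x ∈ boxSites ![0, 0] ![2, 2] ∧ y ∈ boxSites ![0, 0] ![2, 2] := by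
  exact Summit.CriticalPhenomena.SAWScalingLimit.Theorems.NotFKGAtOne.stub_meshBox

/-- STUB 3 (M, hardest) — `BoxCensus` — LANDED (p83729, `Theorems/SAWLeftRightFKGNotFKGAtOneBoxCensus.lean`): for ANY `Ω` whose discrete domain graph is the box graph, the
four counts are `6 / 6 / 12 / 2` (certified enumeration `pathsFrom` + `Measure.count = encard` +
`census_decide`). [folklore] -/
theorem stub_boxCensus :
    ∀ Ω : Set ℂ, (∀ x y : Site 2, (discreteDomainGraph Ω 1).Adj x y ↔
        (zdGraph 2).Adj x y ∧ x ∈ boxSites ![0, 0] ![2, 2] ∧ y ∈ boxSites ![0, 0] ![2, 2]) →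
      Measure.count {γ : SAW.DomainSAW Ω 1 (bx 0 0) (bx 2 2) | 1 ≤ wcross 0 0 γ.walk} = 6 ∧
      Measure.count {γ : SAW.DomainSAW Ω 1 (bx 0 0) (bx 2 2) | 1 ≤ wcross 1 1 γ.walk} = 6 ∧
      Measure.count (Set.univ : Set (SAW.DomainSAW Ω 1 (bx 0 0) (bx 2 2))) = 12 ∧
      Measure.count ({γ : SAW.DomainSAW Ω 1 (bx 0 0) (bx 2 2) | 1 ≤ wcross 0 0 γ.walk} ∩
        {γ | 1 ≤ wcross 1 1 γ.walk}) = 2 := by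
  exact Summit.CriticalPhenomena.SAWScalingLimit.Theorems.NotFKGAtOne.stub_boxCensus

/-- The spelled-out signatures ARE `WindBox`, `MeshBox`, `BoxCensus` (definitionally). [folklore] -/
theorem windBox_def : WindBox ↔ ∀ C : (zdGraph 2).Walk c₀ c₀, C.support.tail =
        [bx 0 (-1), bx 1 (-1), bx 2 (-1), bx 3 (-1), bx 3 0, bx 3 1, bx 3 2, bx 3 3,
        bx 2 3, bx 1 3, bx 0 3, bx (-1) 3, bx (-1) 2, bx (-1) 1, bx (-1) 0, c₀] →
      {z : ℂ | (-1 < z.re ∧ z.re < 3) ∧ (-1 < z.im ∧ z.im < 3)} ⊆ dom C 1 ∧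
        meshVertices (dom C 1) 1 = boxSites ![0, 0] ![2, 2] := Iff.rfl

/-! ## Name-keyed aliases of the three statements (hypotheses of the composition) -/
namespace Registered

/-- Alias of stub 1's signature (`= WindBox`) keyed by the registered stub name. [folklore] -/
abbrev stub_windBox : Prop :=
  ∀ C : (zdGraph 2).Walk c₀ c₀, C.support.tail =
      [bx 0 (-1), bx 1 (-1), bx 2 (-1), bx 3 (-1), bx 3 0, bx 3 1, bx 3 2, bx 3 3,
        bx 2 3, bx 1 3, bx 0 3, bx (-1) 3, bx (-1) 2, bx (-1) 1, bx (-1) 0, c₀] →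
    {z : ℂ | (-1 < z.re ∧ z.re < 3) ∧ (-1 < z.im ∧ z.im < 3)} ⊆ dom C 1 ∧
      meshVertices (dom C 1) 1 = boxSites ![0, 0] ![2, 2]
/-- Alias of stub 2's signature (`= MeshBox`) keyed by the registered stub name. [folklore] -/
abbrev stub_meshBox : Prop :=
  ∀ Ω : Set ℂ, {z : ℂ | (-1 < z.re ∧ z.re < 3) ∧ (-1 < z.im ∧ z.im < 3)} ⊆ Ω →
    meshVertices Ω 1 = boxSites ![0, 0] ![2, 2] →
    ∀ x y : Site 2, (discreteDomainGraph Ω 1).Adj x y ↔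
      (zdGraph 2).Adj x y ∧ x ∈ boxSites ![0, 0] ![2, 2] ∧ y ∈ boxSites ![0, 0] ![2, 2]
/-- Alias of stub 3's signature (`= BoxCensus`) keyed by the registered stub name. [folklore] -/
abbrev stub_boxCensus : Prop :=
  ∀ Ω : Set ℂ, (∀ x y : Site 2, (discreteDomainGraph Ω 1).Adj x y ↔
        (zdGraph 2).Adj x y ∧ x ∈ boxSites ![0, 0] ![2, 2] ∧ y ∈ boxSites ![0, 0] ![2, 2]) →
    Measure.count {γ : SAW.DomainSAW Ω 1 (bx 0 0) (bx 2 2) | 1 ≤ wcross 0 0 γ.walk} = 6 ∧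
    Measure.count {γ : SAW.DomainSAW Ω 1 (bx 0 0) (bx 2 2) | 1 ≤ wcross 1 1 γ.walk} = 6 ∧
    Measure.count (Set.univ : Set (SAW.DomainSAW Ω 1 (bx 0 0) (bx 2 2))) = 12 ∧
    Measure.count ({γ : SAW.DomainSAW Ω 1 (bx 0 0) (bx 2 2) | 1 ≤ wcross 0 0 γ.walk} ∩
      {γ | 1 ≤ wcross 1 1 γ.walk}) = 2

end Registered

/-! ## §4 Composition (kernel-checked, no `sorry`) -/

/-- Stubs 1–3 give the four counts on the witness domain `Ω(sq3)`. [folklore] -/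
theorem counts_sq3 (h₁ : Registered.stub_windBox) (h₂ : Registered.stub_meshBox)
    (h₃ : Registered.stub_boxCensus) : Counts (dom sq3 1) :=
  h₃ (dom sq3 1) (h₂ (dom sq3 1) (h₁ sq3 sq3_support_tail).1 (h₁ sq3 sq3_support_tail).2)

/-- THE LINE: the three stub statements imply the crux BY NAME — the witness datum
`(δ, c, a, b, a', b', C) = (1, (-1,-1), (0,0), (2,2), (0,-1), (2,3), sq3)` violates the ∀-body. [folklore] -/
theorem NotFKGAtOne_of (h₁ : Registered.stub_windBox) (h₂ : Registered.stub_meshBox)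
    (h₃ : Registered.stub_boxCensus) :
    Summit.CriticalPhenomena.SAWScalingLimit.Theses.SAWLeftRightFKG.NotFKGAtOne := by
  unfold NotFKGAtOne
  intro hall
  have h1 := hall 1 c₀ (bx 0 0) (bx 2 2) (bx 0 (-1)) (bx 2 3) sq3
  dsimp only at h1
  obtain ⟨cA, cB, cU, cAB⟩ := counts_sq3 h₁ h₂ h₃
  have key : Measure.count (cornerA (dom sq3 1)) * Measure.count (cornerB (dom sq3 1)) ≤
      Measure.count (univ : Set (SAW.DomainSAW (dom sq3 1) 1 (bx 0 0) (bx 2 2))) *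
        Measure.count (cornerA (dom sq3 1) ∩ cornerB (dom sq3 1)) :=
    h1 one_pos mem_sq3_support_a' mem_sq3_support_b' adj_a_a' adj_b_b' _ _
      (isUp_cornerA (dom sq3 1)) (isUp_cornerB (dom sq3 1))
  rw [cA, cB, cU, cAB] at key
  have e1 : (6 : ℝ≥0∞) * 6 = ((36 : ℕ) : ℝ≥0∞) := by norm_num
  have e2 : (12 : ℝ≥0∞) * 2 = ((24 : ℕ) : ℝ≥0∞) := by norm_num
  rw [e1, e2] at key
  exact absurd (Nat.cast_le.1 key) (by norm_num)

/-- WIRING CHECK: the three registered stubs feed `NotFKGAtOne_of` as stated. -/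
example : Summit.CriticalPhenomena.SAWScalingLimit.Theses.SAWLeftRightFKG.NotFKGAtOne :=
  NotFKGAtOne_of stub_windBox stub_meshBox stub_boxCensus

end Summit.CriticalPhenomena.SAWScalingLimit.Cruxes.NotFKGAtOne.ThreeByThreeCornerWitness

end
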